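import Summits.NavierStokesRegularity.FluidComputer.DampedTransitionQuiet

/-!
# Tao's delay gate under NON-UNIFORM diagonal damping, part 3 of 3: the sharp sub-solution and the
# critical-time window `2 - 24 log K/M - 18η ≤ t_c² ≤ 2 + 2/M + 20η`

Companion file of `DampedTransition.lean`, `DampedTransitionQuiet.lean` (cell `pub-fluidc`, blueprint seat
bp1; the three files are ONE text, split only because files of the summit's topic directory obey the
400-line rule; same namespace `Summit.NavierStokesRegularity.FluidComputer.DampedTransition`). HONEST FRAMING
(verbatim): low prior, high value-of-information experiment on Tao's machine paradigm; NOT a claim that NS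
blows up. Everything here concerns the five-mode truncation (5.5) of [Tao2016AveragedNS, §5.5] in the
retuned form `delayCircuitWith K M ε` with an added diagonal damping `-E(t) * X`, `0 ≤ Eᵢ(t) ≤ η`, the
ODE and the bounds on `E` being assumed on the window `[0,2]` only (local hypotheses, see part 1);
nothing is proved about the Navier–Stokes equations.

* `c_lower_sharp` — the sub-solution `c(t) ≥ (ε²/(4K⁵)) exp((1-θ)Mt²/2 - 2η - M)` on `[K⁻⁵, τ]`
  (`θ = 17K⁻²⁰ + 9η`, `η ≤ 1/10`): the seed `ε²e^{-M}a² ≥ ε²e^{-M}/2` CANNOT be cancelled by damping, and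
  the trigger still sweeps at rate `ε⁻¹Mb - E₂ ≥ (1-θ)Mt - η`.
* `tc_window` — (tcable)/(c-bound) under damping: the first hitting time `t_c` of the level `K⁻¹⁰ε²`
  satisfies `2 - 24 log K/M - 18η ≤ t_c² ≤ 2 + 2/M + 20η`, `1 ≤ t_c ≤ 3/2`, `c(t_c) = K⁻¹⁰ε²`
  (needs `48 log K ≤ M ≤ K¹⁰`, `K ≥ 16`, `ε² ≤ 1/(6K²⁰)`, `η ≤ 1/100`). Undamped ([Tao2016AveragedNS],
  `Thm53With.tc_window`): `2 - 24 log K/M ≤ t_c² ≤ 2 + 2/M`.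
* `quietPhase` — THE RESULT in one statement: existence of `t_c` with that window and the quiet-phase
  portrait `0 ≤ c ≤ K⁻¹⁰ε²`, `|a - 1| ≤ 8K⁻²⁰ + 2η`, `|b - εt| ≤ θεt`, `|d|, |ã| ≤ 3K⁻¹⁰` on `[0, t_c]`,
  for EVERY damping profile `0 ≤ Eᵢ(t) ≤ η ≤ 1/100` (no regularity of `E`; constant rates
  `dᵢ ∈ [0, η]` are the case `E(t) = d`). The tolerance `1/100` is independent of `K`, `M`, `ε`.

What is NOT claimed: the firing phase under damping (successor item); anything about Navier–Stokes.
[cite: Tao2016AveragedNS, §5.5 Thm 5.3, (tcable), (c-bound), proof pp. 28–30]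
-/

noncomputable section

namespace Summit.NavierStokesRegularity.FluidComputer

open Real Set Filter Topology
open Literature.Analysis.FluidPDE.Tao2016AveragedNS
open Literature.Analysis.FluidPDE.Tao2016AveragedNS.Thm53 (antitoneOn_intFactor monotoneOn_intFactor
  antitoneOn_sub_of_deriv_le monotoneOn_sub_of_le_deriv abs_sub_le_of_abs_deriv_le
  init_a init_b init_c init_d init_e)
open Literature.Analysis.FluidPDE.Tao2016AveragedNS.Thm53With (log_facts)

namespace DampedTransition

section CriticalTime

variable {K M ε η τ : ℝ} {E X : ℝ → Fin 5 → ℝ}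

/-- Sharp sub-solution for `c` on `[K⁻⁵, τ]` under damping `η ≤ 1/10` (needs `K⁻⁵ ≤ τ`):
`c(t) ≥ (ε²/(4K⁵)) exp((1-θ)Mt²/2 - 2η - M)`, `θ = 17K⁻²⁰ + 9η` (integrating factor
`exp(-((1-θ)Mt²/2 - ηt))`: `a² ≥ 1/2`, `ε⁻¹Mb ≥ (1-θ)Mt`, `-E₂ ≥ -η`; first on `[0,K⁻⁵]` where the
factor is `≥ 1/2` because `MK⁻¹⁰ ≤ 1`, then on `[K⁻⁵,τ]`). [cite: Tao2016AveragedNS, §5.5 proof of (tcable)] -/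
theorem c_lower_sharp
    (hX : ∀ t ∈ Icc (0:ℝ) 2, HasDerivAt X (delayCircuitWith K M ε (X t) - E t * X t) t)
    (hE : ∀ t ∈ Icc (0:ℝ) 2, ∀ i, 0 ≤ E t i ∧ E t i ≤ η) (h0 : X 0 = delayInit)
    (hε : 0 < ε) (hε1 : ε ≤ 1) (hM0 : 0 < M) (hMK : M ≤ K ^ 10) (hK : 2 ≤ K) (hη : η ≤ 1 / 10)
    (hτ2 : τ ≤ 2) (hτ5 : (K ^ 5)⁻¹ ≤ τ)
    (hεK : ε ^ 2 ≤ 1 / (6 * K ^ 20))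
    (hcτ : ∀ t, 0 ≤ t → t ≤ τ → X t 2 ≤ ε ^ 2 / K ^ 10)
    {t : ℝ} (ht : t ∈ Icc (K ^ 5)⁻¹ τ) :
    ε ^ 2 / (4 * K ^ 5) * exp ((1 - (17 / K ^ 20 + 9 * η)) * M * t ^ 2 / 2 - 2 * η - M) ≤ X t 2 := by
  have hK0 : 0 < K := by linarith
  have hK1 : 1 ≤ K := by linarith
  have hη0 : 0 ≤ η := (hE 0 ⟨le_rfl, zero_le_two⟩ 0).1.trans (hE 0 ⟨le_rfl, zero_le_two⟩ 0).2
  have hK20 : (2 : ℝ) ^ 20 ≤ K ^ 20 := pow_le_pow_left₀ (by norm_num) hK 20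
  set θ : ℝ := 17 / K ^ 20 + 9 * η with hθ
  have hθ0 : 0 ≤ θ := by positivity
  have hθ1 : θ ≤ 1 := by
    have h17 : 17 / K ^ 20 ≤ 1 / 10 := by
      rw [div_le_div_iff₀ (by positivity) (by norm_num)]; norm_num at hK20 ⊢; linarith
    simp only [hθ]; linarith
  have hks₀' : M * ((K ^ 5)⁻¹ * (K ^ 5)⁻¹) ≤ 1 := by
    rw [← mul_inv, ← pow_add, show (5 + 5 : ℕ) = 10 from rfl, ← div_eq_mul_inv,
      div_le_one (by positivity)]
    exact hMK
  set k : ℝ := (1 - θ) * M with hk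
  have hk0 : 0 ≤ k := mul_nonneg (by linarith) hM0.le
  have hkM : k ≤ M := by
    have : (1 - θ) * M ≤ 1 * M := mul_le_mul_of_nonneg_right (by linarith) hM0.le
    simpa [hk] using this
  set μ : ℝ := ε ^ 2 * exp (-M) with hμ
  have hμ0 : 0 ≤ μ := by positivity
  set s₀ : ℝ := (K ^ 5)⁻¹ with hs₀
  have hs₀0 : 0 < s₀ := by positivity
  have hks₀ : k * (s₀ * s₀) ≤ 1 :=
    le_trans (mul_le_mul_of_nonneg_right hkM (mul_self_nonneg _)) hks₀'
  -- integrating factor `G(s) = k s²/2 - η s`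
  have hG : ∀ s, HasDerivAt (fun r : ℝ => k / 2 * (r * r) - η * r) (k * s - η) s := by
    intro s
    have := (((hasDerivAt_id s).mul (hasDerivAt_id s)).const_mul (k / 2)).sub
      ((hasDerivAt_id s).const_mul η)
    exact this.congr_deriv (by simp; ring)
  -- the bracket `(c' - (ks-η)c) e^{-G} ≥ (μ/2) e^{-G}` on `[0,τ]`
  have hbr : ∀ s ∈ Icc 0 τ, μ / 2 * exp (-(k / 2 * (s * s) - η * s)) ≤
      (ε ^ 2 * exp (-M) * X s 0 ^ 2 + ε⁻¹ * M * X s 1 * X s 2 - E s 2 * X s 2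
        - (k * s - η) * X s 2) * exp (-(k / 2 * (s * s) - η * s)) := by
    intro s hs
    have hs2 : s ∈ Icc (0 : ℝ) 2 := ⟨hs.1, hs.2.trans hτ2⟩
    have hc0 : 0 ≤ X s 2 := c_nonneg hX hE h0 hε hε1 hM0.le hs2
    have ha1 : |X s 0 - 1| ≤ 8 / K ^ 20 + 2 * η :=
      a_window hX hE h0 hε hε1 hM0.le hK0 hτ2 hεK hcτ hs
    have hb : |X s 1 - ε * s| ≤ (17 / K ^ 20 + 9 * η) * ε * s :=
      b_window hX hE h0 hε hε1 hM0 hMK hK1 hτ2 hεK hcτ hs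
    -- `a² ≥ 1/2`
    have h8 : 8 / K ^ 20 ≤ 1 / 40 := by
      rw [div_le_div_iff₀ (by positivity) (by norm_num)]; norm_num at hK20 ⊢; linarith
    have ha_lo : 3 / 4 ≤ X s 0 := by have := (abs_le.1 ha1).1; linarith
    have ha2 : 1 / 2 ≤ X s 0 ^ 2 := by nlinarith
    -- `ν b ≥ k s`
    have hνb : k * s ≤ ε⁻¹ * M * X s 1 := by
      have hb' : ε * s - θ * ε * s ≤ X s 1 := by
        have := (abs_le.1 hb).1; simp only [hθ]; linarith
      calc k * s = ε⁻¹ * M * (ε * s - θ * ε * s) := by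
            simp only [hk]; field_simp
        _ ≤ ε⁻¹ * M * X s 1 :=
            mul_le_mul_of_nonneg_left hb' (by have := hM0.le; positivity)
    have h1 : μ / 2 ≤ ε ^ 2 * exp (-M) * X s 0 ^ 2 := by
      have : ε ^ 2 * exp (-M) * (1 / 2) ≤ ε ^ 2 * exp (-M) * X s 0 ^ 2 :=
        mul_le_mul_of_nonneg_left ha2 (by positivity)
      simp only [hμ] at this ⊢; linarith
    have h2 : k * s * X s 2 ≤ ε⁻¹ * M * X s 1 * X s 2 := mul_le_mul_of_nonneg_right hνb hc0
    have h3 : E s 2 * X s 2 ≤ η * X s 2 := mul_le_mul_of_nonneg_right (hE s hs2 2).2 hc0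
    have hbr' : μ / 2 ≤ ε ^ 2 * exp (-M) * X s 0 ^ 2 + ε⁻¹ * M * X s 1 * X s 2 - E s 2 * X s 2
        - (k * s - η) * X s 2 := by
      have e : (k * s - η) * X s 2 = k * s * X s 2 - η * X s 2 := by ring
      linarith
    exact mul_le_mul_of_nonneg_right hbr' (exp_pos _).le
  -- Stage A: on `[0, s₀]`, `e^{-G} ≥ 1/2`, so `c e^{-G} - (μ/4) s` is monotone
  have hs₀τ : s₀ ≤ τ := hτ5
  have hmonoA := monotoneOn_intFactor (s := Icc 0 s₀) (g := fun s => k * s - η)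
    (G := fun r => k / 2 * (r * r) - η * r) (φ := fun _ => μ / 4) (Φ := fun s => μ / 4 * s)
    (convex_Icc 0 s₀) (fun s hs => hasDerivAt_c (hX s ⟨hs.1, hs.2.trans (hs₀τ.trans hτ2)⟩))
    (fun s _ => hG s)
    (fun s _ => ((hasDerivAt_id s).const_mul (μ / 4)).congr_deriv (by simp))
    (fun s hs => by
      have hsτ : s ∈ Icc 0 τ := ⟨hs.1, hs.2.trans hs₀τ⟩
      have hexp : 1 / 2 ≤ exp (-(k / 2 * (s * s) - η * s)) := by
        have hss : k * (s * s) ≤ 1 := by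
          calc k * (s * s) ≤ k * (s₀ * s₀) :=
                mul_le_mul_of_nonneg_left (mul_self_le_mul_self hs.1 hs.2) hk0
            _ ≤ 1 := hks₀
        have harg : -(1 / 2 : ℝ) ≤ -(k / 2 * (s * s) - η * s) := by
          have : 0 ≤ η * s := mul_nonneg hη0 hs.1
          linarith
        calc (1 / 2 : ℝ) ≤ exp (-(1 / 2 : ℝ)) := by
              have h := Real.add_one_le_exp (-(1 / 2 : ℝ))
              linarith
          _ ≤ exp (-(k / 2 * (s * s) - η * s)) := exp_le_exp.2 harg
      calc μ / 4 = μ / 2 * (1 / 2) := by ring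
        _ ≤ μ / 2 * exp (-(k / 2 * (s * s) - η * s)) :=
            mul_le_mul_of_nonneg_left hexp (by positivity)
        _ ≤ _ := hbr s hsτ)
  have hA := hmonoA (⟨le_rfl, hs₀0.le⟩ : (0 : ℝ) ∈ Icc 0 s₀) ⟨hs₀0.le, le_rfl⟩ hs₀0.le
  simp only [init_c h0, zero_mul, mul_zero, sub_zero] at hA
  -- Stage B: on `[s₀, τ]`, `c e^{-G}` is monotone
  have hmonoB := monotoneOn_intFactor (s := Icc s₀ τ) (g := fun s => k * s - η)
    (G := fun r => k / 2 * (r * r) - η * r) (φ := fun _ => 0) (Φ := fun _ => 0)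
    (convex_Icc s₀ τ) (fun s hs => hasDerivAt_c (hX s ⟨hs₀0.le.trans hs.1, hs.2.trans hτ2⟩))
    (fun s _ => hG s)
    (fun s _ => hasDerivAt_const s (0 : ℝ))
    (fun s hs => by
      have hsτ : s ∈ Icc 0 τ := ⟨hs₀0.le.trans hs.1, hs.2⟩
      exact le_trans (by positivity) (hbr s hsτ))
  have hB := hmonoB (⟨le_rfl, hs₀τ⟩ : s₀ ∈ Icc s₀ τ) ht ht.1
  simp only [sub_zero] at hB
  -- combine: `c t e^{-G t} ≥ μ/4 s₀`
  have hct : μ / 4 * s₀ ≤ X t 2 * exp (-(k / 2 * (t * t) - η * t)) := by linarith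
  have ht0 : 0 ≤ t := hs₀0.le.trans ht.1
  have ht2 : t ≤ 2 := ht.2.trans hτ2
  have hE' : X t 2 = X t 2 * exp (-(k / 2 * (t * t) - η * t)) * exp (k / 2 * (t * t) - η * t) := by
    rw [mul_assoc, ← exp_add, neg_add_cancel, exp_zero, mul_one]
  rw [hE']
  calc ε ^ 2 / (4 * K ^ 5) * exp ((1 - (17 / K ^ 20 + 9 * η)) * M * t ^ 2 / 2 - 2 * η - M)
      = μ / 4 * s₀ * exp (k / 2 * (t * t) - 2 * η) := by
        simp only [hμ, hk, hs₀, hθ]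
        rw [show (1 - (17 / K ^ 20 + 9 * η)) * M * t ^ 2 / 2 - 2 * η - M
            = -M + ((1 - (17 / K ^ 20 + 9 * η)) * M / 2 * (t * t) - 2 * η) by ring, exp_add (-M)]
        field_simp
    _ ≤ μ / 4 * s₀ * exp (k / 2 * (t * t) - η * t) := by
        have hηt : η * t ≤ 2 * η := by
          have := mul_le_mul_of_nonneg_left ht2 hη0; linarith
        exact mul_le_mul_of_nonneg_left (exp_le_exp.2 (by linarith)) (by positivity)
    _ ≤ X t 2 * exp (-(k / 2 * (t * t) - η * t)) * exp (k / 2 * (t * t) - η * t) :=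
        mul_le_mul_of_nonneg_right hct (exp_pos _).le

/-- **(tcable) and (c-bound) under damping `η ≤ 1/100`.** If `τ` is the first hitting time of the level
`K⁻¹⁰ε²` by `c` on `[0,2]`, then `2 - 24 log K / M - 18η ≤ τ² ≤ 2 + 2/M + 20η` (so `1 ≤ τ ≤ 3/2`) and
`c(τ) = K⁻¹⁰ε²`. Lower edge: the super-solution of part 2 at the hitting time
(`K⁻¹⁰ ≤ 2e^{(1+θ)Mτ²/2 - M}`, then `log`, then `1/(1+θ) ≥ 1 - θ`); upper edge: the sub-solution at
`T = √(2 + 2/M + 20η)`, where its exponent is already `≥ 0` and `4K⁵ < K¹⁰`. Undamped: `Thm53With.tc_window`.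
[cite: Tao2016AveragedNS, §5.5 (tcable), (c-bound)] -/
theorem tc_window
    (hX : ∀ t ∈ Icc (0:ℝ) 2, HasDerivAt X (delayCircuitWith K M ε (X t) - E t * X t) t)
    (hE : ∀ t ∈ Icc (0:ℝ) 2, ∀ i, 0 ≤ E t i ∧ E t i ≤ η) (h0 : X 0 = delayInit)
    (hε : 0 < ε) (hε1 : ε ≤ 1) (hM0 : 0 < M) (hMK : M ≤ K ^ 10) (hK : 16 ≤ K)
    (hML : 48 * Real.log K ≤ M) (hεK : ε ^ 2 ≤ 1 / (6 * K ^ 20)) (hη : η ≤ 1 / 100)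
    (hτ0 : 0 < τ) (hτ2 : τ ≤ 2)
    (hcτ : ∀ t, 0 ≤ t → t ≤ τ → X t 2 ≤ ε ^ 2 / K ^ 10)
    (hτeq : τ < 2 → X τ 2 = ε ^ 2 / K ^ 10) :
    2 - 24 * Real.log K / M - 18 * η ≤ τ ^ 2 ∧ τ ^ 2 ≤ 2 + 2 / M + 20 * η ∧ 1 ≤ τ ∧ τ ≤ 3 / 2 ∧
      X τ 2 = ε ^ 2 / K ^ 10 := by
  have hK2 : 2 ≤ K := by linarith
  have hK1 : 1 ≤ K := by linarith
  have hK0 : 0 < K := by linarith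
  have hη0 : 0 ≤ η := (hE 0 ⟨le_rfl, zero_le_two⟩ 0).1.trans (hE 0 ⟨le_rfl, zero_le_two⟩ 0).2
  have hη10 : η ≤ 1 / 10 := by linarith
  obtain ⟨hlog, hlog2, hlog0⟩ := log_facts hK
  have hM96 : 96 ≤ M := by linarith
  have hK10 : (16 : ℝ) ^ 10 ≤ K ^ 10 := pow_le_pow_left₀ (by norm_num) hK 10
  have hK10p : 0 < K ^ 10 := by positivity
  have hK20 : K ^ 20 = K ^ 10 * K ^ 10 := by ring
  have hK20ge : (16 : ℝ) ^ 10 * 16 ^ 10 ≤ K ^ 10 * K ^ 10 :=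
    mul_le_mul hK10 hK10 (by positivity) (by positivity)
  obtain ⟨θ, hθ⟩ : ∃ θ : ℝ, θ = 17 / K ^ 20 + 9 * η := ⟨_, rfl⟩
  have hθ0 : 0 ≤ θ := by rw [hθ]; positivity
  have h17 : 17 / K ^ 20 ≤ 1 / 1100 := by
    rw [div_le_div_iff₀ (by positivity) (by norm_num), hK20]
    norm_num at hK20ge ⊢
    linarith
  have hθ11 : θ ≤ 1 / 11 := by rw [hθ]; linarith
  -- late side: `τ² ≤ 2 + 2/M + 20η`
  have hlate : τ ^ 2 ≤ 2 + 2 / M + 20 * η := by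
    by_contra hlt'
    have hlt := not_le.1 hlt'
    have hU0 : 0 < 2 + 2 / M + 20 * η := by positivity
    set T := sqrt (2 + 2 / M + 20 * η) with hT
    have hT0 : 0 ≤ T := sqrt_nonneg _
    have hT2 : T ^ 2 = 2 + 2 / M + 20 * η := sq_sqrt hU0.le
    have hTτ : T < τ := by
      rw [← hT2] at hlt
      exact lt_of_pow_lt_pow_left₀ 2 hτ0.le hlt
    have hT1 : 1 ≤ T := by
      rw [hT, le_sqrt (by norm_num) hU0.le]
      have : 0 ≤ 2 / M := by positivity
      linarith
    have hT5 : (K ^ 5)⁻¹ ≤ T := by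
      have : (K ^ 5)⁻¹ ≤ 1 := inv_le_one_of_one_le₀ (one_le_pow₀ (by linarith))
      linarith
    have hτ5 : (K ^ 5)⁻¹ ≤ τ := by linarith
    have hlow := c_lower_sharp hX hE h0 hε hε1 hM0 hMK hK2 hη10 hτ2 hτ5 hεK hcτ (t := T) ⟨hT5, hTτ.le⟩
    rw [← hθ] at hlow
    have hcT : X T 2 ≤ ε ^ 2 / K ^ 10 := hcτ T (by linarith) hTτ.le
    -- the exponent at `T` is `≥ 0`
    have hexp0 : 0 ≤ (1 - θ) * M * T ^ 2 / 2 - 2 * η - M := by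
      rw [hT2]
      have hexpand : (1 - θ) * M * (2 + 2 / M + 20 * η) / 2 - 2 * η - M
          = 1 - 2 * η - θ - 17 * M / K ^ 20 + M * η * (1 - 10 * θ) := by
        rw [hθ]
        field_simp
        ring
      rw [hexpand]
      have h1 : 17 * M / K ^ 20 ≤ 17 / K ^ 10 := by
        rw [div_le_div_iff₀ (by positivity) hK10p, hK20]
        have := mul_le_mul_of_nonneg_left hMK (by positivity : (0:ℝ) ≤ 17 * K ^ 10)
        linarith
      have h2 : 17 / K ^ 10 ≤ 1 / 2 := by
        rw [div_le_div_iff₀ hK10p (by norm_num)]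
        norm_num at hK10 ⊢
        linarith
      have h3 : 0 ≤ M * η * (1 - 10 * θ) := mul_nonneg (by positivity) (by linarith)
      linarith
    have hexp1 : 1 ≤ exp ((1 - θ) * M * T ^ 2 / 2 - 2 * η - M) := one_le_exp hexp0
    have h : ε ^ 2 / (4 * K ^ 5) ≤ ε ^ 2 / K ^ 10 := by
      have : ε ^ 2 / (4 * K ^ 5) * 1 ≤ ε ^ 2 / (4 * K ^ 5)
          * exp ((1 - θ) * M * T ^ 2 / 2 - 2 * η - M) :=
        mul_le_mul_of_nonneg_left hexp1 (by positivity)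
      linarith [hlow.trans hcT]
    rw [div_le_div_iff₀ (by positivity) hK10p] at h
    have hε2 : 0 < ε ^ 2 := by positivity
    have h' : K ^ 10 ≤ 4 * K ^ 5 := le_of_mul_le_mul_left (by linarith) hε2
    have hK5 : 0 < K ^ 5 := pow_pos hK0 5
    have h5 : (16 : ℝ) ^ 5 ≤ K ^ 5 := pow_le_pow_left₀ (by norm_num) hK 5
    have h'' : K ^ 5 * K ^ 5 ≤ 4 * K ^ 5 := by
      calc K ^ 5 * K ^ 5 = K ^ 10 := by ring
        _ ≤ 4 * K ^ 5 := h'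
    have h4 : K ^ 5 ≤ 4 := le_of_mul_le_mul_right h'' hK5
    norm_num at h5
    linarith
  have hτ32 : τ ≤ 3 / 2 := by
    have h2M : 2 / M ≤ 1 / 48 := by
      rw [div_le_div_iff₀ hM0 (by norm_num)]; linarith
    have hsq : τ ^ 2 ≤ (3 / 2) ^ 2 := by norm_num; linarith
    exact (pow_le_pow_iff_left₀ hτ0.le (by norm_num) two_ne_zero).1 hsq
  have hτlt2 : τ < 2 := by linarith
  have hcτeq := hτeq hτlt2
  -- early side: `2 - 24 log K / M - 18η ≤ τ²`
  have hearly : 2 - 24 * Real.log K / M - 18 * η ≤ τ ^ 2 := by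
    have hup := c_upper_sharp hX hE h0 hε hε1 hM0 hMK hK1 hτ2 hεK hcτ (t := τ) ⟨hτ0.le, le_rfl⟩
    rw [hcτeq, ← hθ] at hup
    -- `1/(2K¹⁰) ≤ exp((1+θ)Mτ²/2 - M)`
    have h1 : 1 / (2 * K ^ 10) ≤ exp ((1 + θ) * M * τ ^ 2 / 2 - M) := by
      rw [div_le_iff₀ (by positivity)]
      have hε2 : 0 < ε ^ 2 := by positivity
      have : ε ^ 2 * 1 ≤ ε ^ 2 * (exp ((1 + θ) * M * τ ^ 2 / 2 - M) * (2 * K ^ 10)) := by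
        calc ε ^ 2 * 1 = ε ^ 2 / K ^ 10 * K ^ 10 := by field_simp
          _ ≤ 2 * ε ^ 2 * exp ((1 + θ) * M * τ ^ 2 / 2 - M) * K ^ 10 :=
              mul_le_mul_of_nonneg_right hup (by positivity)
          _ = ε ^ 2 * (exp ((1 + θ) * M * τ ^ 2 / 2 - M) * (2 * K ^ 10)) := by ring
      exact le_of_mul_le_mul_left this hε2
    have h2 : Real.log (1 / (2 * K ^ 10)) ≤ (1 + θ) * M * τ ^ 2 / 2 - M := by
      have := Real.log_le_log (by positivity) h1
      rwa [Real.log_exp] at this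
    have h3 : Real.log (1 / (2 * K ^ 10)) = -(Real.log 2 + 10 * Real.log K) := by
      rw [one_div, Real.log_inv, Real.log_mul (by norm_num) (by positivity), Real.log_pow]
      push_cast; ring
    rw [h3] at h2
    -- `2M - (1+θ)Mτ² ≤ 2 log 2 + 20 log K ≤ 22 log K`
    have h4 : 2 * M - (1 + θ) * M * τ ^ 2 ≤ 22 * Real.log K := by linarith
    have h5 : 2 - 22 * Real.log K / M ≤ (1 + θ) * τ ^ 2 := by
      have : 2 - (1 + θ) * τ ^ 2 ≤ 22 * Real.log K / M := by
        rw [le_div_iff₀ hM0]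
        have : (2 - (1 + θ) * τ ^ 2) * M = 2 * M - (1 + θ) * M * τ ^ 2 := by ring
        linarith
      linarith
    -- `τ² ≥ (1-θ²)τ² ≥ (1-θ)(2 - 22 log K/M) ≥ 2 - 22 log K/M - 2θ`
    have hx0 : 0 ≤ 22 * Real.log K / M := by positivity
    have h6 : (1 - θ) * (2 - 22 * Real.log K / M) ≤ (1 - θ) * ((1 + θ) * τ ^ 2) :=
      mul_le_mul_of_nonneg_left h5 (by linarith)
    have h7 : 2 - 22 * Real.log K / M - 2 * θ ≤ τ ^ 2 := by
      have hθx : 0 ≤ θ * (22 * Real.log K / M) := mul_nonneg hθ0 hx0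
      have hθτ : 0 ≤ θ ^ 2 * τ ^ 2 := by positivity
      have e1 : (1 - θ) * (2 - 22 * Real.log K / M)
          = 2 - 22 * Real.log K / M - 2 * θ + θ * (22 * Real.log K / M) := by ring
      have e2 : (1 - θ) * ((1 + θ) * τ ^ 2) = τ ^ 2 - θ ^ 2 * τ ^ 2 := by ring
      linarith
    -- `2θ = 34/K²⁰ + 18η` and `34/K²⁰ ≤ 2 log K / M`
    have h34 : 34 / K ^ 20 ≤ 2 * Real.log K / M := by
      rw [div_le_div_iff₀ (by positivity) hM0]
      have e1 : 34 * M ≤ 34 * K ^ 10 := by linarith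
      have e2 : 34 * K ^ 10 ≤ 4 * K ^ 20 := by
        have h34' : (34 : ℝ) ≤ 4 * K ^ 10 := by norm_num at hK10; linarith
        calc 34 * K ^ 10 ≤ 4 * K ^ 10 * K ^ 10 := mul_le_mul_of_nonneg_right h34' hK10p.le
          _ = 4 * K ^ 20 := by ring
      have e3 : 4 * K ^ 20 ≤ 2 * Real.log K * K ^ 20 :=
        mul_le_mul_of_nonneg_right (by linarith) (pow_pos hK0 20).le
      linarith
    have h2θ : 2 * θ = 34 / K ^ 20 + 18 * η := by rw [hθ]; ring
    have h8 : 22 * Real.log K / M + 2 * Real.log K / M = 24 * Real.log K / M := by ring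
    linarith
  have hτ1 : 1 ≤ τ := by
    have h24 : 24 * Real.log K / M ≤ 1 / 2 := by
      rw [div_le_div_iff₀ hM0 (by norm_num)]; linarith
    have hsq : (1 : ℝ) ^ 2 ≤ τ ^ 2 := by rw [one_pow]; linarith
    exact (pow_le_pow_iff_left₀ (by norm_num) hτ0.le two_ne_zero).1 hsq
  exact ⟨hearly, hlate, hτ1, hτ32, hcτeq⟩

/-- **THE QUIET PHASE OF TAO'S DELAY GATE SURVIVES NON-UNIFORM DIAGONAL DAMPING OF RELATIVE SIZE
`η ≤ 1/100`** — a tolerance independent of `K`, `M`, `ε`. For every damping profile `E` with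
`0 ≤ Eᵢ(t) ≤ η ≤ 1/100` (no regularity; constant rates `dᵢ ∈ [0,η]` are `E(t) = d`) and every global
trajectory of `Ẋ = delayCircuitWith K M ε X - E(t) * X` from `(1,0,0,0,0)` (`48 log K ≤ M ≤ K¹⁰`, `K ≥ 16`,
`ε² ≤ 1/(6K²⁰)`): there is a critical time `t_c`, `2 - 24 log K/M - 18η ≤ t_c² ≤ 2 + 2/M + 20η`
(`1 ≤ t_c ≤ 3/2`), at which the trigger reaches the level `c(t_c) = K⁻¹⁰ε²` of (c-bound), and on `[0,t_c]`
the gate is quiet: `0 ≤ c ≤ K⁻¹⁰ε²`, `|a - 1| ≤ 8K⁻²⁰ + 2η`, `|b - εt| ≤ (17K⁻²⁰ + 9η)εt`,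
`|d|, |ã| ≤ 3K⁻¹⁰`. (Undamped, [Tao2016AveragedNS, Thm 5.3 (tcable)]: `2 - 24 log K/M ≤ t_c² ≤ 2 + 2/M`.)
The firing phase under damping is NOT treated here. [cite: Tao2016AveragedNS, §5.5 Thm 5.3, (tcable), (c-bound)] -/
theorem quietPhase
    (hX : ∀ t ∈ Icc (0:ℝ) 2, HasDerivAt X (delayCircuitWith K M ε (X t) - E t * X t) t)
    (hE : ∀ t ∈ Icc (0:ℝ) 2, ∀ i, 0 ≤ E t i ∧ E t i ≤ η) (h0 : X 0 = delayInit)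
    (hε : 0 < ε) (hε1 : ε ≤ 1) (hM0 : 0 < M) (hMK : M ≤ K ^ 10) (hK : 16 ≤ K)
    (hML : 48 * Real.log K ≤ M) (hεK : ε ^ 2 ≤ 1 / (6 * K ^ 20)) (hη : η ≤ 1 / 100) :
    ∃ τ : ℝ, (2 - 24 * Real.log K / M - 18 * η ≤ τ ^ 2 ∧ τ ^ 2 ≤ 2 + 2 / M + 20 * η ∧
        1 ≤ τ ∧ τ ≤ 3 / 2) ∧ X τ 2 = ε ^ 2 / K ^ 10 ∧
      ∀ t ∈ Icc 0 τ, (0 ≤ X t 2 ∧ X t 2 ≤ ε ^ 2 / K ^ 10) ∧ |X t 0 - 1| ≤ 8 / K ^ 20 + 2 * η ∧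
        |X t 1 - ε * t| ≤ (17 / K ^ 20 + 9 * η) * ε * t ∧ |X t 3| ≤ 3 / K ^ 10 ∧ |X t 4| ≤ 3 / K ^ 10 := by
  have hK0 : 0 < K := by linarith
  have hK1 : 1 ≤ K := by linarith
  have hlev : X 0 2 < ε ^ 2 / K ^ 10 := by rw [init_c h0]; positivity
  obtain ⟨τ, hτ0, hτ2, hcτ, hτeq⟩ :=
    exists_hitTime_on (θ := ε ^ 2 / K ^ 10) two_pos (continuousOn_traj hX 2) hlev
  obtain ⟨hlo, hhi, hτ1, hτ32, hceq⟩ :=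
    tc_window hX hE h0 hε hε1 hM0 hMK hK hML hεK hη hτ0 hτ2 hcτ hτeq
  refine ⟨τ, ⟨hlo, hhi, hτ1, hτ32⟩, hceq, fun t ht => ⟨⟨?_, hcτ t ht.1 ht.2⟩, ?_, ?_, ?_⟩⟩
  · exact c_nonneg hX hE h0 hε hε1 hM0.le ⟨ht.1, ht.2.trans hτ2⟩
  · exact a_window hX hE h0 hε hε1 hM0.le hK0 hτ2 hεK hcτ ht
  · exact b_window hX hE h0 hε hε1 hM0 hMK hK1 hτ2 hεK hcτ ht
  · exact de_small hX hE h0 hε hε1 hM0.le hK0 hτ2 hcτ ht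

end CriticalTime

end DampedTransition

end Summit.NavierStokesRegularity.FluidComputer
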